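import Summits.QuantumFields.YangMills.Theorems.UnitScaleGibbsActionDerivativeSlotDerivatives
import Literature.MathematicalPhysics.QuantumFieldTheory.Balaban1983to89.Node00.WilsonActionSecondVariationL2Letters
import Mathlib.Analysis.Calculus.Deriv.Shift
import HarnessLib

/-!
# The slot observables ARE the derivatives along the simultaneous LEFT flow: `actionDeriv = (d∕dt) A(e^{tu}·U)∣₀`, `actionDeriv₂ = (d∕dt)² A(e^{tu}·U)∣₀` —
# the dictionary from the Schwinger–Dyson rows (`Σ_b X′_b`) to Node00's `deriv (deriv …)` letters in print's LEFT chart `U′U₀`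

Crux of record `UnitScaleTilt.HistoryTailL` (stmt-QuantumFields-19936), cell `ym3-torus` (YM ladder rung R3 = continuum SU(2) Yang–Mills on T³ — a RUNG, NOT the Clay problem);
width seat `ym3-torus-px17` gen 7.  LINE 28's skeleton v1 (`Cruxes/HistoryTailL/…gross_transfer`, ideator ym-r3-idea-2 g16) states `stub_condSD` and `stub_hessOnEvent` in the
currency of this seat's slot calculus (✓ `UnitScaleGibbsActionDerivativeSlotCalculus`: `actionDeriv ρ u`, `actionDeriv₂ ρ u`, `slotBond`), while the tree's Hessian LETTERS for the
Wilson action live in Node00's `deriv (deriv (t ↦ A(…)))` currency — right chart `expChart U (t•X) = U·e^{tX}` (`WilsonActionSecondVariationGauge`) AND print's left chart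
`e^{tY}·U` (`WilsonActionSecondVariationLeftChart`: `deriv_deriv_wilsonAction4_leftChart_eq`, ★★ `abs_deriv_deriv_wilsonAction4_leftChart_sub_flat_le_local`,
`abs_deriv_deriv_wilsonAction4_leftChart_le`; the incidence count `sum_plaq_boundary_sq_le`).  THIS FILE IS THE DICTIONARY (matrix model, then `SU(N)`):

* §1 (matrix model `ρ : G →* M_N(ℂ)`, flows `ρ(k b t) = exp(t u_b)`): `hasDerivAt_slotIns_flow`, ★★ `hasDerivAt_actionDeriv_flow : HasDerivAt (t ↦ actionDeriv ρ u (e ↦ k e t·U_e)) (actionDeriv₂ ρ u U) 0`,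
  `flow_mul_flow`, ★ `hasDerivAt_wilsonAction4_flow_at` (the first derivative at EVERY `t` is `actionDeriv` at the flowed field), ★★ `deriv_wilsonAction4_flow`,
  ★★★ `deriv_deriv_wilsonAction4_flow : deriv (deriv (s ↦ A(e ↦ k e s·U_e))) 0 = actionDeriv₂ ρ u U`;
* §2 (`SU(N)`, `ρ = fundamentalRep`, `Y : bonds → 𝔰𝔲(N)` = Node00's `lieSU`, `u_b = (Y_b : M_N(ℂ))`, `k b t = expSU (t • Y_b)`): `expSU_smul_flow`, `fundamentalRep_expSU_smul`,
  ★★★ `actionDeriv₂_eq_deriv_deriv_leftChart : actionDeriv₂ (fundamentalRep (Fin N)) (b ↦ ↑(Y b)) U = deriv (deriv fun t => wilsonAction4 (fun b => expSU ((t • Y) b) * U b)) 0`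
  (Node00's `Q^L_U(Y)` VERBATIM), ★★ `actionDeriv_eq_deriv_leftChart`; and the two letters the skeleton's `stub_hessOnEvent` wants, now BY NAME in `actionDeriv₂` currency:
  ★★ `abs_actionDeriv₂_sub_flat_le_local` (= Node00 ★★ letter (b): `|actionDeriv₂ − Q_1(Y)| ≤ 8·Σ_p δ_p (Σ_k‖Y_{b_k}‖)²` when `‖U_b − 1‖ ≤ δ_p` on `∂p`) and
  ★ `abs_actionDeriv₂_le_opNorm` (`|actionDeriv₂| ≤ Σ_p(Σ_k‖Y_{b_k}‖)²`, operator norms — Node00's global letter, the `L²`-operator twin of ✓∕⧗ `abs_actionDeriv₂_le`);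
* §3 ★ `hessianBound_le_sum_norm_sq : hessianBound u ≤ 8(d−1)∕N · Σ_b ‖u_b‖_F²` (Node00's incidence count `sum_plaq_boundary_sq_le`) — the skeleton's off-event term `C·Σ_b‖u_b‖²`.

HONEST SCOPE.  A dictionary and two re-readings of LANDED Node00 letters; nothing of `stub_hessOnEvent`∕`stub_condSD`∕`stub_linTest`∕`stub_peierls0` as registered statements,
«ShallowFluxSecondMomentL», (Q), K1, `MeanDeviationL`, `HistoryTailL`, R3, d = 4, a continuum limit or a mass gap is proved; LINE 28's skeleton is not yet registered on an item; the
Yang–Mills mass gap is NOT proved.  THEOREMS ONLY (0 `def`, 0 `sorry`); `--supports stmt-QuantumFields-19936 --as helper`.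

References: T. Bałaban, CMP 99 (1985) 389–434, (3.1)–(3.7) pp.390–391 (the left perturbation `U′U₀`) [Balaban1985BackgroundPropagators]; T. Bałaban, CMP 122 (1989) 355–392,
(1.7) p.358, (1.16) p.360 [Balaban1989LargeFieldII]; L. Gross, CMP 92 (1983) 137–162, proof of Thm 2.2 [GrossCMP1983]; M. Creutz, Quarks, Gluons and Lattices (2022) Ch. 11 [Creutz2022].
-/

set_option autoImplicit false

noncomputable section

open MeasureTheory Filter Topology NormedSpace
open scoped BigOperators
open Literature.MathematicalPhysics.QuantumFieldTheory.Balaban1983to89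
open Literature.MathematicalPhysics.QuantumLattice (fundamentalRep)
open Summit.QuantumFields.YangMills.Theorems.UnitScaleGibbsOneBondSchwingerDyson (update_mul_zero)
open Summit.QuantumFields.YangMills.Cruxes.CurvatureAmnesia.WardDefect.SchwingerDyson (hasDerivAt_exp_coe_smul hasDerivAt_reTrace)
open Summit.QuantumFields.YangMills.Theorems.UnitScaleGibbsActionDerivativeSlotCalculus

namespace Summit.QuantumFields.YangMills.Theorems.UnitScaleGibbsActionDerivativeFlowHessian

/-! ## §1 The simultaneous left flow: first derivative at every time, second derivative at zero (matrix model) -/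

section MatrixModel

open scoped Matrix.Norms.Frobenius

variable {N : ℕ} {P : Params} {j : ℕ} {G : Type} [GaugeGroup G]
  {ρ : G →* Matrix (Fin N) (Fin N) ℂ} {u : PBond P j → Matrix (Fin N) (Fin N) ℂ} {k : PBond P j → ℝ → G}

/-- Along the simultaneous flow a FIRST insertion moves with derivative the second insertion. [cite: Creutz2022, Ch. 11] -/
theorem hasDerivAt_slotIns_flow (hk : ∀ b s t, k b (s + t) = k b s * k b t) (hkX : ∀ b t, ρ (k b t) = exp ((t : ℂ) • u b))
    (U : GaugeField P j G) (p : Plaq P j) (i : Fin 4) :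
    HasDerivAt (fun t : ℝ => slotIns ρ u (fun e => k e t * U e) p i) (slotIns₂ ρ u U p i) 0 := by
  fin_cases i
  · show HasDerivAt (fun t : ℝ => slotIns ρ u (fun e => k e t * U e) p 0) (slotIns₂ ρ u U p 0) 0
    simp only [slotIns, slotIns₂, Matrix.cons_val_zero]
    exact (hasDerivAt_factor_flow (ρ := ρ) (u := u) hkX ⟨p.src, p.μ⟩ U).const_mul _
  · show HasDerivAt (fun t : ℝ => slotIns ρ u (fun e => k e t * U e) p 1) (slotIns₂ ρ u U p 1) 0
    simp only [slotIns, slotIns₂, Matrix.cons_val_one, Matrix.cons_val_zero]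
    exact (hasDerivAt_factor_flow (ρ := ρ) (u := u) hkX ⟨p.src.shift p.μ, p.ν⟩ U).const_mul _
  · show HasDerivAt (fun t : ℝ => slotIns ρ u (fun e => k e t * U e) p 2) (slotIns₂ ρ u U p 2) 0
    simp only [slotIns, slotIns₂, Matrix.cons_val]
    exact (hasDerivAt_factor_inv_flow (ρ := ρ) (u := u) hk hkX ⟨p.src.shift p.ν, p.μ⟩ U).mul_const _
  · show HasDerivAt (fun t : ℝ => slotIns ρ u (fun e => k e t * U e) p 3) (slotIns₂ ρ u U p 3) 0
    simp only [slotIns, slotIns₂, Matrix.cons_val]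
    exact (hasDerivAt_factor_inv_flow (ρ := ρ) (u := u) hk hkX ⟨p.src, p.ν⟩ U).mul_const _

/-- The slots of the once-inserted word along the simultaneous flow. [cite: Creutz2022, Ch. 11] -/
theorem hasDerivAt_insSlot_flow (hk : ∀ b s t, k b (s + t) = k b s * k b t) (hkX : ∀ b t, ρ (k b t) = exp ((t : ℂ) • u b))
    (U : GaugeField P j G) (p : Plaq P j) (i l : Fin 4) :
    HasDerivAt (fun t : ℝ => Function.update (slot ρ (fun e => k e t * U e) p) i (slotIns ρ u (fun e => k e t * U e) p i) l)
      (if l = i then slotIns₂ ρ u U p i else slotIns ρ u U p l) 0 := by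
  by_cases hl : l = i
  · subst hl
    simp only [Function.update_self, if_true]
    exact hasDerivAt_slotIns_flow hk hkX U p l
  · simp only [Function.update_of_ne hl, hl, if_false]
    exact hasDerivAt_slot_flow hk hkX U p l

/-- The simultaneous flow starts at `U`. [folklore] -/
theorem flow_zero' (hk : ∀ b s t, k b (s + t) = k b s * k b t) (U : GaugeField P j G) : (fun e => k e 0 * U e) = U :=
  funext fun e => by rw [flow_zero hk, one_mul]

/-- ★★ **`actionDeriv₂` IS THE DERIVATIVE OF `actionDeriv` ALONG THE SIMULTANEOUS FLOW**: `HasDerivAt (t ↦ X_u(e^{tu}·U)) (actionDeriv₂ ρ u U) 0` — the sixteen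
double-insertion words `word₂ p i l` are exactly the slot derivatives of the once-inserted words. [cite: GrossCMP1983, Thm 2.2 (proof); Creutz2022, Ch. 11] -/
theorem hasDerivAt_actionDeriv_flow (hk : ∀ b s t, k b (s + t) = k b s * k b t) (hkX : ∀ b t, ρ (k b t) = exp ((t : ℂ) • u b))
    (U : GaugeField P j G) :
    HasDerivAt (fun t : ℝ => actionDeriv ρ u (fun e => k e t * U e)) (actionDeriv₂ ρ u U) 0 := by
  unfold actionDeriv actionDeriv₂
  refine HasDerivAt.fun_sum fun p _ => HasDerivAt.fun_sum fun i _ => ?_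
  have hw := hasDerivAt_word
    (S := fun t => Function.update (slot ρ (fun e => k e t * U e) p) i (slotIns ρ u (fun e => k e t * U e) p i))
    (D := fun l => if l = i then slotIns₂ ρ u U p i else slotIns ρ u U p l)
    (fun l => hasDerivAt_insSlot_flow hk hkX U p i l)
  have h0 : Function.update (slot ρ (fun e => k e 0 * U e) p) i (slotIns ρ u (fun e => k e 0 * U e) p i) =
      Function.update (slot ρ U p) i (slotIns ρ u U p i) := by rw [flow_zero' hk U]
  rw [h0] at hw
  have h : HasDerivAt (fun t : ℝ => -((word (Function.update (slot ρ (fun e => k e t * U e) p) i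
        (slotIns ρ u (fun e => k e t * U e) p i))).trace.re / (N : ℝ)))
      (-((∑ l, word (Function.update (Function.update (slot ρ U p) i (slotIns ρ u U p i)) l
        (if l = i then slotIns₂ ρ u U p i else slotIns ρ u U p l))).trace.re / (N : ℝ))) 0 :=
    ((hasDerivAt_reTrace hw).div_const (N : ℝ)).neg
  refine h.congr_deriv ?_
  rw [Matrix.trace_sum, Complex.re_sum, Finset.sum_div, ← Finset.sum_neg_distrib]
  rfl

/-- Flows compose: `e ↦ k e s · (k e t · U_e)` is the flow at time `s + t`. [folklore] -/
theorem flow_mul_flow (hk : ∀ b s t, k b (s + t) = k b s * k b t) (U : GaugeField P j G) (s t : ℝ) :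
    (fun e => k e s * (k e t * U e)) = fun e => k e (s + t) * U e :=
  funext fun e => by rw [hk, mul_assoc]

/-- ★ **THE FIRST DERIVATIVE AT EVERY TIME**: along the simultaneous flow, `s ↦ A(e ↦ k e s·U_e)` has derivative `actionDeriv ρ u (e ↦ k e t·U_e)` at `s = t`
(flow property + ✓ `hasDerivAt_wilsonAction4_flow` at the flowed field). [cite: GrossCMP1983, Thm 2.2 (proof)] -/
theorem hasDerivAt_wilsonAction4_flow_at (hre : ∀ g : G, reTr g = (ρ g).trace.re / N)
    (hk : ∀ b s t, k b (s + t) = k b s * k b t) (hkX : ∀ b t, ρ (k b t) = exp ((t : ℂ) • u b)) (U : GaugeField P j G) (t : ℝ) :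
    HasDerivAt (fun s : ℝ => wilsonAction4 (fun e => k e s * U e)) (actionDeriv ρ u (fun e => k e t * U e)) t := by
  have h0 := hasDerivAt_wilsonAction4_flow (u := u) hre hk hkX (fun e => k e t * U e)
  -- `s ↦ A(k e s · (k e t · U e)) = A(k e (s + t) · U e)`; shift the base point
  have hfun : (fun s : ℝ => wilsonAction4 (fun e => k e s * (k e t * U e))) = fun s : ℝ => wilsonAction4 (fun e => k e (s + t) * U e) := by
    funext s; rw [flow_mul_flow hk U s t]
  rw [hfun] at h0
  have h1 : HasDerivAt (fun s : ℝ => wilsonAction4 (fun e => k e (s + t) * U e)) (actionDeriv ρ u (fun e => k e t * U e)) (t - t) := by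
    rw [sub_self]; exact h0
  have h2 := HasDerivAt.comp_sub_const t t h1
  simp only [sub_add_cancel] at h2
  exact h2

/-- ★★ **`deriv (s ↦ A(flow_s U)) = (t ↦ actionDeriv ρ u (flow_t U))`.** [cite: GrossCMP1983, Thm 2.2 (proof)] -/
theorem deriv_wilsonAction4_flow (hre : ∀ g : G, reTr g = (ρ g).trace.re / N)
    (hk : ∀ b s t, k b (s + t) = k b s * k b t) (hkX : ∀ b t, ρ (k b t) = exp ((t : ℂ) • u b)) (U : GaugeField P j G) :
    deriv (fun s : ℝ => wilsonAction4 (fun e => k e s * U e)) = fun t => actionDeriv ρ u (fun e => k e t * U e) :=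
  funext fun t => (hasDerivAt_wilsonAction4_flow_at hre hk hkX U t).deriv

/-- ★★★ **THE SECOND DERIVATIVE OF THE ACTION ALONG THE SIMULTANEOUS LEFT FLOW IS `actionDeriv₂`**: `deriv (deriv (s ↦ A(e ↦ k e s·U_e))) 0 = actionDeriv₂ ρ u U`.
[cite: GrossCMP1983, Thm 2.2 (proof); Balaban1985BackgroundPropagators, (3.6)–(3.7) p.391] -/
theorem deriv_deriv_wilsonAction4_flow (hre : ∀ g : G, reTr g = (ρ g).trace.re / N)
    (hk : ∀ b s t, k b (s + t) = k b s * k b t) (hkX : ∀ b t, ρ (k b t) = exp ((t : ℂ) • u b)) (U : GaugeField P j G) :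
    deriv (deriv (fun s : ℝ => wilsonAction4 (fun e => k e s * U e))) 0 = actionDeriv₂ ρ u U := by
  rw [deriv_wilsonAction4_flow hre hk hkX U]
  exact (hasDerivAt_actionDeriv_flow hk hkX U).deriv

/-- ★★ `deriv (s ↦ A(flow_s U)) 0 = actionDeriv ρ u U`. [cite: GrossCMP1983, Thm 2.2 (proof)] -/
theorem deriv_wilsonAction4_flow_zero (hre : ∀ g : G, reTr g = (ρ g).trace.re / N)
    (hk : ∀ b s t, k b (s + t) = k b s * k b t) (hkX : ∀ b t, ρ (k b t) = exp ((t : ℂ) • u b)) (U : GaugeField P j G) :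
    deriv (fun s : ℝ => wilsonAction4 (fun e => k e s * U e)) 0 = actionDeriv ρ u U := by
  rw [(hasDerivAt_wilsonAction4_flow hre hk hkX U).deriv]

end MatrixModel

/-! ## §2 `SU(N)` in Node00's left chart `e^{tY}·U` -/

section SpecialUnitary

open T4AdjointCovarianceUnitary (lieSU expSU coe_expSU specialUnitaryAd)
open Literature.MathematicalPhysics.QuantumFieldTheory.Balaban1983to89.Node00
open scoped Matrix.Norms.L2Operator

variable {N : ℕ} {P : Params} {j : ℕ}

/-- The rays `t ↦ expSU (t • Y)` are multiplicative. [cite: Balaban1985BackgroundPropagators, (3.1)–(3.2) p.390] -/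
theorem expSU_smul_flow (Y : lieSU (Fin N)) (s t : ℝ) : expSU ((s + t) • Y) = expSU (s • Y) * expSU (t • Y) := by
  apply Subtype.ext
  change NormedSpace.exp (((s + t) • Y : lieSU (Fin N)) : Matrix (Fin N) (Fin N) ℂ) =
    NormedSpace.exp ((s • Y : lieSU (Fin N)) : Matrix (Fin N) (Fin N) ℂ) * NormedSpace.exp ((t • Y : lieSU (Fin N)) : Matrix (Fin N) (Fin N) ℂ)
  rw [Submodule.coe_smul, Submodule.coe_smul, Submodule.coe_smul, add_smul]
  exact Matrix.exp_add_of_commute _ _ (((Commute.refl (Y : Matrix (Fin N) (Fin N) ℂ)).smul_left s).smul_right t)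

/-- `fundamentalRep (expSU (t • Y)) = exp (t • ↑Y)` (complex scalar). [cite: Balaban1985BackgroundPropagators, (3.1) p.390] -/
theorem fundamentalRep_expSU_smul (Y : lieSU (Fin N)) (t : ℝ) :
    fundamentalRep (Fin N) (expSU (t • Y)) = NormedSpace.exp ((t : ℂ) • (Y : Matrix (Fin N) (Fin N) ℂ)) := by
  change ((expSU (t • Y) : Matrix.specialUnitaryGroup (Fin N) ℂ) : Matrix (Fin N) (Fin N) ℂ) = _
  rw [coe_expSU, Submodule.coe_smul, Complex.coe_smul]

variable [NeZero N]

/-- The normalised-trace model identity for `SU(N)`. [folklore] -/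
theorem reTr_eq_fundamentalRep (g : Matrix.specialUnitaryGroup (Fin N) ℂ) : reTr g = (fundamentalRep (Fin N) g).trace.re / N := by
  show UnitaryModel.nReTr (g : Matrix (Fin N) (Fin N) ℂ) = _
  simp [UnitaryModel.nReTr, Fintype.card_fin, Literature.MathematicalPhysics.QuantumLattice.fundamentalRep_apply]

/-- ★★★ **THE DICTIONARY**: for `Y : bonds → 𝔰𝔲(N)`, `actionDeriv₂ (fundamentalRep (Fin N)) (b ↦ ↑(Y b)) U = deriv (deriv (t ↦ A(b ↦ expSU((t•Y) b)·U_b))) 0` — this seat's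
summed Hessian IS Node00's left-chart second variation `Q^L_U(Y)` (hence, by ✓ `deriv_deriv_wilsonAction4_leftChart_eq`, the right-chart one at `Ad_{U⁻¹}Y`).
[cite: Balaban1985BackgroundPropagators, (3.1)–(3.7) pp.390–391; GrossCMP1983, Thm 2.2 (proof)] -/
theorem actionDeriv₂_eq_deriv_deriv_leftChart (U : GaugeField P j (Matrix.specialUnitaryGroup (Fin N) ℂ)) (Y : PBond P j → lieSU (Fin N)) :
    actionDeriv₂ (fundamentalRep (Fin N)) (fun b => (Y b : Matrix (Fin N) (Fin N) ℂ)) U =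
      deriv (deriv fun t : ℝ => wilsonAction4 (fun b => expSU ((t • Y) b) * U b)) 0 := by
  have h := deriv_deriv_wilsonAction4_flow (ρ := fundamentalRep (Fin N)) (u := fun b => (Y b : Matrix (Fin N) (Fin N) ℂ))
    (k := fun b t => expSU (t • Y b)) reTr_eq_fundamentalRep (fun b s t => expSU_smul_flow (Y b) s t)
    (fun b t => fundamentalRep_expSU_smul (Y b) t) U
  simp only [Pi.smul_apply]
  exact h.symm

/-- ★★ The first-order dictionary: `actionDeriv (fundamentalRep (Fin N)) (b ↦ ↑(Y b)) U = deriv (t ↦ A(b ↦ expSU((t•Y) b)·U_b)) 0`.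
[cite: Balaban1985BackgroundPropagators, (3.6) p.391] -/
theorem actionDeriv_eq_deriv_leftChart (U : GaugeField P j (Matrix.specialUnitaryGroup (Fin N) ℂ)) (Y : PBond P j → lieSU (Fin N)) :
    actionDeriv (fundamentalRep (Fin N)) (fun b => (Y b : Matrix (Fin N) (Fin N) ℂ)) U =
      deriv (fun t : ℝ => wilsonAction4 (fun b => expSU ((t • Y) b) * U b)) 0 := by
  have h := deriv_wilsonAction4_flow_zero (ρ := fundamentalRep (Fin N)) (u := fun b => (Y b : Matrix (Fin N) (Fin N) ℂ))
    (k := fun b t => expSU (t • Y b)) reTr_eq_fundamentalRep (fun b s t => expSU_smul_flow (Y b) s t)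
    (fun b t => fundamentalRep_expSU_smul (Y b) t) U
  simp only [Pi.smul_apply]
  exact h.symm

/-- ★★ **THE ON-EVENT LETTER IN `actionDeriv₂` CURRENCY** (Node00 ★★ letter (b), left chart, BY NAME): if `‖U_b − 1‖ ≤ δ_p` on the four bonds of every plaquette `p`, then
`|actionDeriv₂ … U − Q_1(Y)| ≤ 8·Σ_p δ_p·(Σ_k‖Y_{b_k}‖)²`, `Q_1(Y) = deriv (deriv (t ↦ A(expChart 1 (t•Y)))) 0` the flat quadratic form (operator norms on the right).
[cite: Balaban1989LargeFieldII, (1.7) p.358; Balaban1985BackgroundPropagators, (3.10) p.392] -/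
theorem abs_actionDeriv₂_sub_flat_le_local (U : GaugeField P j (Matrix.specialUnitaryGroup (Fin N) ℂ)) (Y : PBond P j → lieSU (Fin N)) (δ : Plaq P j → ℝ)
    (hδ : ∀ p : Plaq P j, ‖(U ⟨p.src, p.μ⟩ : Matrix (Fin N) (Fin N) ℂ) - 1‖ ≤ δ p ∧ ‖(U ⟨p.src.shift p.μ, p.ν⟩ : Matrix (Fin N) (Fin N) ℂ) - 1‖ ≤ δ p
      ∧ ‖(U ⟨p.src.shift p.ν, p.μ⟩ : Matrix (Fin N) (Fin N) ℂ) - 1‖ ≤ δ p ∧ ‖(U ⟨p.src, p.ν⟩ : Matrix (Fin N) (Fin N) ℂ) - 1‖ ≤ δ p) :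
    |actionDeriv₂ (fundamentalRep (Fin N)) (fun b => (Y b : Matrix (Fin N) (Fin N) ℂ)) U
        - deriv (deriv fun t : ℝ => wilsonAction4 (expChart (1 : GaugeField P j (Matrix.specialUnitaryGroup (Fin N) ℂ)) (t • Y))) 0|
      ≤ 8 * ∑ p : Plaq P j, δ p * (‖(Y ⟨p.src, p.μ⟩ : Matrix (Fin N) (Fin N) ℂ)‖ + ‖(Y ⟨p.src.shift p.μ, p.ν⟩ : Matrix (Fin N) (Fin N) ℂ)‖
        + ‖(Y ⟨p.src.shift p.ν, p.μ⟩ : Matrix (Fin N) (Fin N) ℂ)‖ + ‖(Y ⟨p.src, p.ν⟩ : Matrix (Fin N) (Fin N) ℂ)‖) ^ 2 := by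
  rw [actionDeriv₂_eq_deriv_deriv_leftChart]
  exact abs_deriv_deriv_wilsonAction4_leftChart_sub_flat_le_local U Y δ hδ

/-- ★ **THE GLOBAL LETTER IN `actionDeriv₂` CURRENCY, OPERATOR NORMS** (Node00, BY NAME): `|actionDeriv₂ … U| ≤ Σ_p (Σ_k‖Y_{b_k}‖)²` — the `L²`-operator twin of
`UnitScaleGibbsActionDerivativeGaussianDomination.abs_actionDeriv₂_le` (Frobenius, `∕N`). [cite: Balaban1985BackgroundPropagators, (3.10) p.392] -/
theorem abs_actionDeriv₂_le_opNorm (U : GaugeField P j (Matrix.specialUnitaryGroup (Fin N) ℂ)) (Y : PBond P j → lieSU (Fin N)) :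
    |actionDeriv₂ (fundamentalRep (Fin N)) (fun b => (Y b : Matrix (Fin N) (Fin N) ℂ)) U|
      ≤ ∑ p : Plaq P j, (‖(Y ⟨p.src, p.μ⟩ : Matrix (Fin N) (Fin N) ℂ)‖ + ‖(Y ⟨p.src.shift p.μ, p.ν⟩ : Matrix (Fin N) (Fin N) ℂ)‖
        + ‖(Y ⟨p.src.shift p.ν, p.μ⟩ : Matrix (Fin N) (Fin N) ℂ)‖ + ‖(Y ⟨p.src, p.ν⟩ : Matrix (Fin N) (Fin N) ℂ)‖) ^ 2 := by
  rw [actionDeriv₂_eq_deriv_deriv_leftChart]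
  exact abs_deriv_deriv_wilsonAction4_leftChart_le U Y

end SpecialUnitary

/-! ## §3 The crude constant against the 1-form mass -/

section Count

open scoped Matrix.Norms.Frobenius
open Literature.MathematicalPhysics.QuantumFieldTheory.Balaban1983to89.Node00 (sum_plaq_boundary_sq_le)

variable {N : ℕ} {P : Params} {j : ℕ}

/-- ★ **`hessianBound u ≤ 8(d−1)∕N · Σ_b ‖u_b‖_F²`** (Cauchy–Schwarz on the four letters + Node00's incidence count ✓ `sum_plaq_boundary_sq_le`) — the off-event constant of
the skeleton's `stub_hessOnEvent` against the 1-form mass `Σ_b ‖u_b‖²`. [cite: Balaban1989LargeFieldII, (1.7) p.358] -/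
theorem hessianBound_le_sum_norm_sq (u : PBond P j → Matrix (Fin N) (Fin N) ℂ) :
    hessianBound u ≤ 8 * ((P.d : ℝ) - 1) / N * ∑ b : PBond P j, ‖u b‖ ^ 2 := by
  unfold hessianBound
  have hN : (0 : ℝ) ≤ (N : ℝ) := Nat.cast_nonneg N
  have h := sum_plaq_boundary_sq_le (P := P) (j := j) (fun b => ‖u b‖)
  have hslot : ∀ p : Plaq P j, ∑ i : Fin 4, ‖u (slotBond p i)‖ =
      ‖u ⟨p.src, p.μ⟩‖ + ‖u ⟨p.src.shift p.μ, p.ν⟩‖ + ‖u ⟨p.src.shift p.ν, p.μ⟩‖ + ‖u ⟨p.src, p.ν⟩‖ := fun p => by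
    simp only [Fin.sum_univ_four, slotBond, Matrix.cons_val_zero, Matrix.cons_val_one, Matrix.cons_val]
  simp only [hslot]
  calc (∑ p : Plaq P j, (‖u ⟨p.src, p.μ⟩‖ + ‖u ⟨p.src.shift p.μ, p.ν⟩‖ + ‖u ⟨p.src.shift p.ν, p.μ⟩‖ + ‖u ⟨p.src, p.ν⟩‖) ^ 2) / N
      ≤ (8 * ((P.d : ℝ) - 1) * ∑ b : PBond P j, ‖u b‖ ^ 2) / N := div_le_div_of_nonneg_right h hN
    _ = 8 * ((P.d : ℝ) - 1) / N * ∑ b : PBond P j, ‖u b‖ ^ 2 := by ring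

end Count

end Summit.QuantumFields.YangMills.Theorems.UnitScaleGibbsActionDerivativeFlowHessian

end
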